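import Literature.Probability.RandomPlanarGeometry.SLERestrictionMartingale
import HarnessLib

/-!
# [LSW] Thm. 6.1 for two-sided hulls: assembly of `sle_restriction_eightThirds`

Level 5 (top) of the decomposition of the named fact `Literature.Probability.RandomPlanarGeometry.sle_restriction_eightThirds`
(`RestrictionHulls`; plan in `SLERestrictionMartingale`), after

* G. F. Lawler, O. Schramm, W. Werner, *Conformal restriction: the chordal case*, J. Amer. Math.
  Soc. **16** (2003) 917–955, arXiv:math/0209343 (**[LSW]**), Thm. 6.1 and its proof (§6);
* G. F. Lawler, *Conformally Invariant Processes in the Plane*, AMS (2005) (**[Law]**), §6.4,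
  Thm. 6.17 and its proof.

`SLERestrictionSmooth` proves Thm. 6.1, `P[γ[0,∞) ∩ A = ∅] = Φ'_A(0)^{5/8}`, for every hull
`A ∈ 𝒬₊ ∪ 𝒬₋` from the printed ingredients. For a TWO-SIDED `A ∈ 𝒬*` both printed proofs only
say "By Proposition 3.3 [(4) ⇒ (3)], it suffices to consider the case where `A` is a smooth
hull in `𝒬₊ ∪ 𝒬₋`" ([LSW]) / "Using Lemma 5.19 [= [LSW] Lemma 2.1] we can see that it suffices
to prove (6.6) for smooth Jordan hulls `A ∈ 𝒬₊`" ([Law] p. 160). This file supplies an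
argument for the two-sided case along the martingale route, with `A = A₊ ⊔ A₋` the
`±`-decomposition of the tree (`IsStarHull.sidePart_decomposition`, `HullDecomposition`; [LSW]
§2 p. 8), from three inputs on `A` which the caller proves (`SLERestrictionSlidHull`):

* (lim-sup) on `{T_A = ∞}` the restriction martingale `Y^A` of `A` gets arbitrarily close to
  `1` at large times — the property `sle_restrictionDeriv_frequently_gt A` of
  `SLERestrictionMartingale`, hypothesis `hA62` below ([Law] p. 161 "`lim sup_{t → ∞} M_t^{8/5}
  = 1` on the event `V_A`", printed for smooth Jordan hulls of `𝒬₊`; for two-sided `A` the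
  caller derives it from [LSW] Lemma 6.2 for `A₊` and for `A₋` at the same exit times and the
  subadditivity `1 − Φ'_{B₁ ∪ B₂}(0) ≤ (1 − Φ'_{B₁}(0)) + (1 − Φ'_{B₂}(0))` of
  `RestrictionSubadditivity`);
* (domination) `Y^A ≤ Y^{A₊}` and `Y^A ≤ Y^{A₋}` before `T_A`, by the MONOTONICITY of
  `B ↦ Φ'_B(0)` ([LSW] proof of Lemma 6.2: "`g_B'(W)` … is monotone decreasing in `B`") applied
  to the slid hulls `A_t − W_t ⊇ (A₊)_t − W_t` — isolated as the hypothesis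
  `sle_restrictionDeriv_dominated A A₊` (a parametric `Prop`, discharged in
  `SLERestrictionSlidHull` from the tree's `HasRestrictionDeriv.le_of_subset` and the fact that
  slid hulls of `*`-hulls are `*`-hulls);
* (one-sided theorem) Thm. 6.1 for `A₊` and `A₋` (`SLERestrictionSmooth`).

Then on `{T_A < ∞}` the trace hits `A₊` (say) at `T_A = T_{A₊}`; the restriction martingale of
the ONE-SIDED hull `A₊` has left limit `0` there — not by Lemma 6.3 (`A₊` need not be smooth)
but because Thm. 6.1 holds for `A₊`: `E[Y^{A₊}_∞] = Φ'_{A₊}(0)^{5/8} = P[T_{A₊} = ∞]` while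
`Y^{A₊}_∞ = 1` on `{T_{A₊} = ∞}` and `Y^{A₊}_∞ ≥ 0`, so `Y^{A₊}_∞ = 0` a.s. on `{T_{A₊} < ∞}`
(`IsRestrictionMartingale.ae_apply_eq_zero_of_measure_eq`), and `Y^A ≤ Y^{A₊}`; hence
`Y^A_∞ = 1_{T_A = ∞}` and `E[Y^A_∞] = Y^A_0` give Thm. 6.1 for `A`
(`IsRestrictionMartingale.measure_disjoint_eq_of_limits`).

Main results (PROVED): `Literature.Probability.RandomPlanarGeometry.sle_restrictionDeriv_frequently_lt_of_dominated` (the Lemma 6.3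
property of a two-sided hull from domination by its side parts) and
`Literature.Probability.RandomPlanarGeometry.sle_measure_disjoint_eq_of_sideParts` (Thm. 6.1 for `A = A₊ ⊔ A₋` from Thm. 6.1 for the
parts, their restriction martingales, the lim-sup property of `A` and domination); the
marginal measurability of the trace (`hmeas`, the tree's `aemeasurable_sleTrace`, proved in
`SLETraceMeasurable`) is used to see that the avoidance event is null-measurable
(`nullMeasurableSet_disjoint_range`). The assembly of `sle_restriction_eightThirds` for all of
`𝒬*` is `SLERestrictionSlidHull`.
-/

noncomputable section

open Set Filter Topology MeasureTheory Metric
open UpperHalfPlane (upperHalfPlaneSet isOpen_upperHalfPlaneSet)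
open scoped NNReal ENNReal

namespace Literature.Probability.RandomPlanarGeometry

variable {A A' : Set ℂ} {Y Y' : ℝ≥0 → (ℝ≥0 → ℝ) → ℝ}

/-! ### Domination of the slid derivatives of a hull by those of a sub-hull -/

/-- **Domination along the SLE_{8/3} flow** (a parametric `Prop`, not asserted): for
`A' ⊆ A`, almost surely, at every time `t` before the hitting time of `A`,
`Φ'_{A_t − W_t}(0) ≤ Φ'_{A'_t − W_t}(0)` for all restriction data of the two slid hulls. This
is the monotonicity "`g_B'(W)` is monotone decreasing in `B`" ([LSW] proof of Lemma 6.2, p. 14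
of the arXiv version) at the slid hulls `B = A_t − W_t ⊇ B' = A'_t − W_t`; it is DISCHARGED
for `*`-hulls `A' ⊆ A` in `SLERestrictionSlidHull` (`sle_restrictionDeriv_dominated_of_subset`,
from the monotonicity `HasRestrictionDeriv.le_of_subset` of `HullSubordination` and the fact that
slid hulls of `*`-hulls are `*`-hulls). [cite: LawlerSchrammWerner2003Restriction, proof of Lemma 6.2 (monotonicity of g_B'(W) in B)] -/
def sle_restrictionDeriv_dominated (A A' : Set ℂ) : Prop :=
  ∀ᵐ ω ∂Process.preWienerMeasure, ∀ t : ℝ≥0,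
    (t : WithTop ℝ≥0) < firstHit (sleTrace ((8 : ℝ≥0) / 3) ω) A →
      ∀ (Ψ : ConformalEquiv
          (upperHalfPlaneSet \ Loewner.slidHull (sleDriving ((8 : ℝ≥0) / 3) ω) A t)
          upperHalfPlaneSet) (e : ℝ)
        (Ψ' : ConformalEquiv
          (upperHalfPlaneSet \ Loewner.slidHull (sleDriving ((8 : ℝ≥0) / 3) ω) A' t)
          upperHalfPlaneSet) (e' : ℝ),
        IsRestrictionMap (Loewner.slidHull (sleDriving ((8 : ℝ≥0) / 3) ω) A t) Ψ →
          HasRestrictionDeriv (Loewner.slidHull (sleDriving ((8 : ℝ≥0) / 3) ω) A t) Ψ e →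
            IsRestrictionMap (Loewner.slidHull (sleDriving ((8 : ℝ≥0) / 3) ω) A' t) Ψ' →
              HasRestrictionDeriv (Loewner.slidHull (sleDriving ((8 : ℝ≥0) / 3) ω) A' t) Ψ' e' →
                e ≤ e'

/-! ### Measurability of the avoidance event -/

/-- **The avoidance event `{γ[0,∞) ∩ A = ∅}` is null-measurable** for a random path with
continuous trajectories and a.e.-measurable marginals (for the SLE trace:
`aemeasurable_sleTrace`, proved in `SLETraceMeasurable`) and a closed `A`: its complement is
`⋃ₙ ⋂ₖ ⋃ᵢ {uᵢ ≤ n, dist(γ(uᵢ), A) < 1/(k+1)}` for a dense sequence `(uᵢ)` of times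
(continuity, and compactness of `[0, n]`). [folklore] -/
theorem nullMeasurableSet_disjoint_range {P : Measure (ℝ≥0 → ℝ)} {γ : (ℝ≥0 → ℝ) → ℝ≥0 → ℂ}
    (hγc : ∀ ω, Continuous (γ ω)) (hγm : ∀ t, AEMeasurable (fun ω ↦ γ ω t) P) (hA : IsClosed A) :
    NullMeasurableSet {ω | Disjoint (range (γ ω)) A} P := by
  rcases A.eq_empty_or_nonempty with rfl | hne
  · simp
  obtain ⟨u, hu⟩ := TopologicalSpace.exists_dense_seq ℝ≥0
  set S : Set (ℝ≥0 → ℝ) := ⋃ n : ℕ, ⋂ k : ℕ, ⋃ i : ℕ,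
    {ω | (u i : ℝ) ≤ n ∧ infDist (γ ω (u i)) A < 1 / ((k : ℝ) + 1)} with hS
  have hSm : NullMeasurableSet S P := by
    refine .iUnion fun n ↦ .iInter fun k ↦ .iUnion fun i ↦ ?_
    by_cases hi : (u i : ℝ) ≤ n
    · have : {ω | (u i : ℝ) ≤ n ∧ infDist (γ ω (u i)) A < 1 / ((k : ℝ) + 1)} =
          (fun ω ↦ infDist (γ ω (u i)) A) ⁻¹' Iio (1 / ((k : ℝ) + 1)) := by
        ext ω; simp [hi]
      rw [this]
      exact ((continuous_infDist_pt A).measurable.comp_aemeasurable (hγm (u i))).nullMeasurable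
        measurableSet_Iio
    · have : {ω | (u i : ℝ) ≤ n ∧ infDist (γ ω (u i)) A < 1 / ((k : ℝ) + 1)} = ∅ := by
        ext ω; simp [hi]
      rw [this]
      exact nullMeasurableSet_empty
  have hcompl : {ω | Disjoint (range (γ ω)) A}ᶜ = S := by
    ext ω
    simp only [mem_compl_iff, mem_setOf_eq, hS, mem_iUnion, mem_iInter]
    constructor
    · intro h
      rw [Set.not_disjoint_iff] at h
      obtain ⟨_, ⟨t, rfl⟩, htA⟩ := h
      obtain ⟨n, hn⟩ := exists_nat_gt (t : ℝ)
      refine ⟨n, fun k ↦ ?_⟩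
      -- near `t` the distance to `A` is small; the dense sequence enters that neighbourhood
      have hcont : ContinuousAt (fun s ↦ infDist (γ ω s) A) t :=
        ((continuous_infDist_pt A).comp (hγc ω)).continuousAt
      have h0 : infDist (γ ω t) A = 0 := infDist_zero_of_mem htA
      have hopen : IsOpen {s : ℝ≥0 | infDist (γ ω s) A < 1 / ((k : ℝ) + 1) ∧ (s : ℝ) < n} := by
        refine IsOpen.inter ?_ ?_
        · exact isOpen_lt ((continuous_infDist_pt A).comp (hγc ω)) continuous_const
        · exact isOpen_lt NNReal.continuous_coe continuous_const
      have ht : t ∈ {s : ℝ≥0 | infDist (γ ω s) A < 1 / ((k : ℝ) + 1) ∧ (s : ℝ) < n} :=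
        ⟨by rw [h0]; positivity, hn⟩
      obtain ⟨i, hi⟩ := hu.exists_mem_open hopen ⟨t, ht⟩
      exact ⟨i, hi.2.le, hi.1⟩
    · rintro ⟨n, hn⟩
      choose i hi using hn
      -- the times `u (i k)` lie in the compact `[0, n]`; along a subsequence they converge
      have hmem : ∀ k, u (i k) ∈ Icc (0 : ℝ≥0) n := fun k ↦ ⟨bot_le, by exact_mod_cast (hi k).1⟩
      obtain ⟨t, -, φ, hφ, hlim⟩ := isCompact_Icc.tendsto_subseq hmem
      have hdist : Tendsto (fun k ↦ infDist (γ ω (u (i (φ k)))) A) atTop (𝓝 (infDist (γ ω t) A)) :=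
        (((continuous_infDist_pt A).comp (hγc ω)).tendsto t).comp hlim
      have hsmall : Tendsto (fun k ↦ infDist (γ ω (u (i (φ k)))) A) atTop (𝓝 0) := by
        refine squeeze_zero (fun k ↦ infDist_nonneg) (fun k ↦ (hi (φ k)).2.le) ?_
        have h1 : Tendsto (fun k : ℕ ↦ 1 / ((k : ℝ) + 1)) atTop (𝓝 0) :=
          tendsto_one_div_add_atTop_nhds_zero_nat
        exact h1.comp hφ.tendsto_atTop
      have h0 : infDist (γ ω t) A = 0 := tendsto_nhds_unique hdist hsmall
      have htA : γ ω t ∈ A := by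
        rw [← hA.closure_eq, mem_closure_iff_infDist_zero hne]
        exact h0
      exact Set.not_disjoint_iff.2 ⟨γ ω t, mem_range_self t, htA⟩
  have : {ω | Disjoint (range (γ ω)) A} = Sᶜ := by rw [← hcompl, compl_compl]
  rw [this]
  exact hSm.compl

/-! ### The frozen value of a restriction martingale vanishes on `{T < ∞}` when Thm. 6.1 holds -/

/-- **If Thm. 6.1 holds for `A'`, its restriction martingale is `0` from `T_{A'}` on, almost
surely on `{T_{A'} < ∞}`.** With `L = lim_{n→∞} Y'_n` (which exists a.s.: the limit at `∞`
on `{T = ∞}`, the frozen value on `{T < ∞}`): `E[L] = lim E[Y'_n] = Φ'_{A'}(0)^{5/8}`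
(martingale, dominated convergence), `= P[T = ∞]` (Thm. 6.1 for `A'`, hypothesis `hF`), while
`L = 1` on `{T = ∞}` (the property `sle_restrictionDeriv_frequently_gt A'`, `h62`) and
`L ≥ 0`; so `L − 1_{T = ∞} ≥ 0` has integral `0` and vanishes a.s. This replaces Lemma 6.3
for the (non-smooth) side parts of a two-sided hull. Measurability of `{T = ∞}`: marginal
a.e.-measurability of the trace (`hmeas`, = `aemeasurable_sleTrace`). [folklore] -/
theorem IsRestrictionMartingale.ae_apply_eq_zero_of_measure_eq
    [Fact Process.isProjectiveLimit_preWienerMeasure] (huniq : IsStarHull.existsUnique_isRestrictionMap)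
    (hex : IsStarHull.exists_hasRestrictionDeriv)
    (hmeas : ∀ t : ℝ≥0, AEMeasurable (fun ω ↦ sleTrace ((8 : ℝ≥0) / 3) ω t) Process.preWienerMeasure)
    (hA' : IsStarHull A') {Φ' : ConformalEquiv (upperHalfPlaneSet \ A') upperHalfPlaneSet}
    (hΦ' : IsRestrictionMap A' Φ') {d' : ℝ} (hd' : HasRestrictionDeriv A' Φ' d')
    (hY' : IsRestrictionMartingale A' Y') (h62 : sle_restrictionDeriv_frequently_gt A')
    (hF : Process.preWienerMeasure {ω | Disjoint (range (sleTrace ((8 : ℝ≥0) / 3) ω)) A'} =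
      ENNReal.ofReal (d' ^ ((5 : ℝ) / 8))) :
    ∀ᵐ ω ∂Process.preWienerMeasure, ∀ τ : ℝ≥0, firstHit (sleTrace ((8 : ℝ≥0) / 3) ω) A' = τ →
      ∀ t : ℝ≥0, τ ≤ t → Y' t ω = 0 := by
  set P : Measure (ℝ≥0 → ℝ) := Process.preWienerMeasure with hP
  -- a.s. the values from `T` on are all equal to the value at `T` (the left limit)
  have hconst : ∀ᵐ ω ∂P, ∀ τ : ℝ≥0, firstHit (sleTrace ((8 : ℝ≥0) / 3) ω) A' = τ →
      ∀ t : ℝ≥0, τ ≤ t → Y' t ω = Y' τ ω := by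
    filter_upwards [hY'.ae_frozen] with ω hfrozen τ hτ t hτt
    have hτ0 : 0 < τ := by
      have h := firstHit_sleTrace_pos ((8 : ℝ≥0) / 3) hA'.isBoundedHull.isClosed hA'.zero_notMem ω
      rw [hτ] at h
      exact_mod_cast h
    haveI : (𝓝[<] τ).NeBot := nhdsLT_neBot_of_exists_lt ⟨0, hτ0⟩
    exact tendsto_nhds_unique (hfrozen τ hτ t hτt) (hfrozen τ hτ τ le_rfl)
  -- on `{T = τ}`, `Y'_n → Y'_τ`
  have hlimτ : ∀ ω τ, (∀ t : ℝ≥0, τ ≤ t → Y' t ω = Y' τ ω) →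
      Tendsto (fun n : ℕ ↦ Y' n ω) atTop (𝓝 (Y' τ ω)) := by
    intro ω τ hc
    refine tendsto_const_nhds.congr' ?_
    obtain ⟨N, hN⟩ := exists_nat_ge (τ : ℝ)
    filter_upwards [eventually_ge_atTop N] with n hn
    refine (hc n ?_).symm
    have : (τ : ℝ) ≤ n := hN.trans (by exact_mod_cast hn)
    exact_mod_cast this
  -- the a.s. limit `L` of `Y'_n`
  have hlimex : ∀ᵐ ω ∂P, ∃ c : ℝ, Tendsto (fun n : ℕ ↦ Y' n ω) atTop (𝓝 c) := by
    filter_upwards [hY'.ae_exists_tendsto, hconst] with ω hlim hc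
    by_cases hTω : firstHit (sleTrace ((8 : ℝ≥0) / 3) ω) A' = ⊤
    · obtain ⟨c, hc'⟩ := hlim hTω
      exact ⟨c, hc'.comp tendsto_natCast_atTop_atTop⟩
    · obtain ⟨τ, hτ⟩ := WithTop.ne_top_iff_exists.1 hTω
      exact ⟨Y' τ ω, hlimτ ω τ (hc τ hτ.symm)⟩
  classical
  obtain ⟨L, hLlim⟩ : ∃ L : (ℝ≥0 → ℝ) → ℝ,
      ∀ᵐ ω ∂P, Tendsto (fun n : ℕ ↦ Y' n ω) atTop (𝓝 (L ω)) :=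
    ⟨fun ω ↦ if h : ∃ c : ℝ, Tendsto (fun n : ℕ ↦ Y' n ω) atTop (𝓝 c) then h.choose else 0, by
      filter_upwards [hlimex] with ω hω
      rw [dif_pos hω]
      exact hω.choose_spec⟩
  -- `E[L] = d'^{5/8}` by dominated convergence
  have hmeasY : ∀ n : ℕ, AEStronglyMeasurable (Y' n) P := fun n ↦
    (hY'.martingale.integrable _).aestronglyMeasurable
  have hbound : ∀ n : ℕ, ∀ᵐ ω ∂P, ‖Y' n ω‖ ≤ (1 : ℝ) := fun n ↦
    Eventually.of_forall fun ω ↦ by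
      rw [Real.norm_eq_abs, abs_le]
      have h := hY'.mem_Icc n ω
      exact ⟨by linarith [h.1], h.2⟩
  have hDCT := tendsto_integral_of_dominated_convergence (fun _ ↦ (1 : ℝ)) hmeasY
    (integrable_const 1) hbound hLlim
  have hLint : ∫ ω, L ω ∂P = d' ^ ((5 : ℝ) / 8) := by
    refine tendsto_nhds_unique hDCT ?_
    have : (fun n : ℕ ↦ ∫ ω, Y' n ω ∂P) = fun _ ↦ d' ^ ((5 : ℝ) / 8) :=
      funext fun n ↦ hY'.integral_eq huniq hA' hΦ' hd' n
    rw [this]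
    exact tendsto_const_nhds
  have hLm : AEStronglyMeasurable L P := aestronglyMeasurable_of_tendsto_ae atTop hmeasY hLlim
  have hL01 : ∀ᵐ ω ∂P, L ω ∈ Icc (0 : ℝ) 1 := by
    filter_upwards [hLlim] with ω hω
    exact isClosed_Icc.mem_of_tendsto hω (Eventually.of_forall fun n ↦ hY'.mem_Icc n ω)
  have hLi : Integrable L P :=
    MemLp.integrable le_top (memLp_top_of_bound hLm 1 (by
      filter_upwards [hL01] with ω hω
      rw [Real.norm_eq_abs, abs_le]
      exact ⟨by linarith [hω.1], hω.2⟩))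
  -- `L = 1` on `E = {T = ∞}`
  set E : Set (ℝ≥0 → ℝ) := {ω | Disjoint (range (sleTrace ((8 : ℝ≥0) / 3) ω)) A'} with hE
  have hmemE : ∀ {ω}, ω ∈ E ↔ firstHit (sleTrace ((8 : ℝ≥0) / 3) ω) A' = ⊤ := fun {ω} ↦ by
    simp only [hE, mem_setOf_eq, firstHit_eq_top_iff_disjoint]
  have hL1 : ∀ᵐ ω ∂P, ω ∈ E → L ω = 1 := by
    filter_upwards [hY'.ae_tendsto_one h62, hLlim] with ω h1 hω hωE
    exact tendsto_nhds_unique hω ((h1 (hmemE.1 hωE)).comp tendsto_natCast_atTop_atTop)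
  -- `E` is null-measurable, of probability `d'^{5/8}`
  have hEnull : NullMeasurableSet E P :=
    nullMeasurableSet_disjoint_range (fun ω ↦ continuous_sleTrace _ ω) hmeas
      hA'.isBoundedHull.isClosed
  have hd'0 : 0 ≤ d' := by
    obtain ⟨d₀, h0, -, hd₀⟩ := hex hA' hΦ'
    rw [hd'.unique hA' hd₀]
    exact h0.le
  have hPE : P.real E = d' ^ ((5 : ℝ) / 8) := by
    rw [measureReal_def, show P E = ENNReal.ofReal (d' ^ ((5 : ℝ) / 8)) from hF,
      ENNReal.toReal_ofReal (Real.rpow_nonneg hd'0 _)]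
  obtain ⟨E', -, hE'm, hE'eq⟩ := hEnull.exists_measurable_subset_ae_eq
  set χ : (ℝ≥0 → ℝ) → ℝ := E'.indicator fun _ ↦ (1 : ℝ) with hχ
  have hχint : Integrable χ P := (integrable_const (1 : ℝ)).indicator hE'm
  have hχE : ∫ ω, χ ω ∂P = d' ^ ((5 : ℝ) / 8) := by
    rw [hχ, integral_indicator_const _ hE'm, smul_eq_mul, mul_one, ← hPE]
    exact measureReal_congr hE'eq
  have hχae : ∀ᵐ ω ∂P, χ ω = E.indicator (fun _ ↦ (1 : ℝ)) ω :=
    indicator_ae_eq_of_ae_eq_set hE'eq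
  -- `L - χ ≥ 0` a.e. with integral `0`, hence `L = χ` a.e.
  have hnonneg : 0 ≤ᵐ[P] fun ω ↦ L ω - χ ω := by
    filter_upwards [hL1, hL01, hχae] with ω h1 h01 hχω
    rw [Pi.zero_apply, sub_nonneg, hχω]
    by_cases hω : ω ∈ E
    · rw [indicator_of_mem hω, h1 hω]
    · rw [indicator_of_notMem hω]
      exact h01.1
  have hint0 : ∫ ω, (L ω - χ ω) ∂P = 0 := by
    rw [integral_sub hLi hχint, hLint, hχE, sub_self]
  have hae0 := (integral_eq_zero_iff_of_nonneg_ae hnonneg (hLi.sub hχint)).1 hint0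
  -- conclusion
  filter_upwards [hae0, hconst, hLlim, hχae] with ω h0 hc hω hχω τ hτ t hτt
  have hωE : ω ∉ E := fun hωE ↦ by
    have := hmemE.1 hωE
    rw [hτ] at this
    exact WithTop.coe_ne_top this
  have hL0 : L ω = 0 := by
    have : L ω - χ ω = 0 := h0
    rwa [hχω, indicator_of_notMem hωE, sub_zero] at this
  rw [hc τ hτ t hτt, ← tendsto_nhds_unique hω (hlimτ ω τ (hc τ hτ)), hL0]

/-! ### The Lemma 6.3 property of a hull from domination by sub-hulls -/

/-- **The vanishing property `sle_restrictionDeriv_frequently_lt A` of a hull `A = A₊ ∪ A₋`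
from its parts**: if the restriction martingales of the parts `A₊, A₋ ⊆ A` vanish from their
hitting times on (`hp0`, `hm0`, cf. `ae_apply_eq_zero_of_measure_eq`) and the slid derivatives
of `A` are dominated by those of each part (`hdp`, `hdm`), then, almost surely on
`{T_A < ∞}`, `Φ'_{A_s − W_s}(0) < ε` for `s < T_A` close to `T_A` (for all restriction data):
the trace hits, say, `A₊` at `T_A = T_{A₊}`, `Y^{A₊}_s = Φ'_{(A₊)_s − W_s}(0)^{5/8} → 0` as
`s ↗ T_A`, and `Φ'_{A_s − W_s}(0) ≤ Φ'_{(A₊)_s − W_s}(0)`. [folklore] -/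
theorem sle_restrictionDeriv_frequently_lt_of_dominated (hA : IsStarHull A)
    {Ap Am : Set ℂ} (hunion : Ap ∪ Am = A) {Yp Ym : ℝ≥0 → (ℝ≥0 → ℝ) → ℝ} (hYp : IsRestrictionMartingale Ap Yp)
    (hYm : IsRestrictionMartingale Am Ym)
    (hp0 : ∀ᵐ ω ∂Process.preWienerMeasure, ∀ τ : ℝ≥0, firstHit (sleTrace ((8 : ℝ≥0) / 3) ω) Ap = τ →
      ∀ t : ℝ≥0, τ ≤ t → Yp t ω = 0)
    (hm0 : ∀ᵐ ω ∂Process.preWienerMeasure, ∀ τ : ℝ≥0, firstHit (sleTrace ((8 : ℝ≥0) / 3) ω) Am = τ →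
      ∀ t : ℝ≥0, τ ≤ t → Ym t ω = 0)
    (hdp : sle_restrictionDeriv_dominated A Ap) (hdm : sle_restrictionDeriv_dominated A Am) :
    sle_restrictionDeriv_frequently_lt A := by
  have h0A : (0 : ℂ) ∉ A := hA.zero_notMem
  -- one side, abstractly
  have side : ∀ {B : Set ℂ} {Z : ℝ≥0 → (ℝ≥0 → ℝ) → ℝ}, B ⊆ A → IsRestrictionMartingale B Z →
      ∀ ω, (∀ t : ℝ≥0, (t : WithTop ℝ≥0) < firstHit (sleTrace ((8 : ℝ≥0) / 3) ω) B →
        ∃ (Ψ : ConformalEquiv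
            (upperHalfPlaneSet \ Loewner.slidHull (sleDriving ((8 : ℝ≥0) / 3) ω) B t)
            upperHalfPlaneSet) (e : ℝ),
          IsRestrictionMap (Loewner.slidHull (sleDriving ((8 : ℝ≥0) / 3) ω) B t) Ψ ∧
            HasRestrictionDeriv (Loewner.slidHull (sleDriving ((8 : ℝ≥0) / 3) ω) B t) Ψ e ∧
            0 < e ∧ e ≤ 1 ∧ Z t ω = e ^ ((5 : ℝ) / 8)) →
      (∀ τ : ℝ≥0, firstHit (sleTrace ((8 : ℝ≥0) / 3) ω) B = τ →
        ∀ t : ℝ≥0, τ ≤ t → Tendsto (fun s ↦ Z s ω) (𝓝[<] τ) (𝓝 (Z t ω))) →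
      (∀ τ : ℝ≥0, firstHit (sleTrace ((8 : ℝ≥0) / 3) ω) B = τ → ∀ t : ℝ≥0, τ ≤ t → Z t ω = 0) →
      (∀ t : ℝ≥0, (t : WithTop ℝ≥0) < firstHit (sleTrace ((8 : ℝ≥0) / 3) ω) A →
        ∀ (Ψ : ConformalEquiv
            (upperHalfPlaneSet \ Loewner.slidHull (sleDriving ((8 : ℝ≥0) / 3) ω) A t)
            upperHalfPlaneSet) (e : ℝ)
          (Ψ' : ConformalEquiv
            (upperHalfPlaneSet \ Loewner.slidHull (sleDriving ((8 : ℝ≥0) / 3) ω) B t)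
            upperHalfPlaneSet) (e' : ℝ),
          IsRestrictionMap (Loewner.slidHull (sleDriving ((8 : ℝ≥0) / 3) ω) A t) Ψ →
            HasRestrictionDeriv (Loewner.slidHull (sleDriving ((8 : ℝ≥0) / 3) ω) A t) Ψ e →
              IsRestrictionMap (Loewner.slidHull (sleDriving ((8 : ℝ≥0) / 3) ω) B t) Ψ' →
                HasRestrictionDeriv (Loewner.slidHull (sleDriving ((8 : ℝ≥0) / 3) ω) B t) Ψ' e' →
                  e ≤ e') →
      ∀ τ : ℝ≥0, 0 < τ → firstHit (sleTrace ((8 : ℝ≥0) / 3) ω) A = τ →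
        firstHit (sleTrace ((8 : ℝ≥0) / 3) ω) B = τ →
        ∀ ε : ℝ, 0 < ε → ∃ᶠ s : ℝ≥0 in 𝓝[<] τ,
          ∀ (Ψ : ConformalEquiv
              (upperHalfPlaneSet \ Loewner.slidHull (sleDriving ((8 : ℝ≥0) / 3) ω) A s)
              upperHalfPlaneSet) (e : ℝ),
            IsRestrictionMap (Loewner.slidHull (sleDriving ((8 : ℝ≥0) / 3) ω) A s) Ψ →
              HasRestrictionDeriv (Loewner.slidHull (sleDriving ((8 : ℝ≥0) / 3) ω) A s) Ψ e →
                e < ε := by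
    intro B Z hBA hZ ω hrpow hfrozen hzero hdom τ hτ0 hτA hτB ε hε
    haveI : (𝓝[<] τ).NeBot := nhdsLT_neBot_of_exists_lt ⟨0, hτ0⟩
    -- `Z_s → Z_τ = 0` as `s ↗ τ`
    have hlim : Tendsto (fun s ↦ Z s ω) (𝓝[<] τ) (𝓝 0) := by
      have := hfrozen τ hτB τ le_rfl
      rwa [hzero τ hτB τ le_rfl] at this
    have hεp : 0 < ε ^ ((5 : ℝ) / 8) := Real.rpow_pos_of_pos hε _
    have hev : ∀ᶠ s : ℝ≥0 in 𝓝[<] τ, Z s ω < ε ^ ((5 : ℝ) / 8) := hlim (Iio_mem_nhds hεp)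
    have hlt : ∀ᶠ s : ℝ≥0 in 𝓝[<] τ, s < τ := self_mem_nhdsWithin
    refine ((hev.and hlt).mono ?_).frequently
    rintro s ⟨hs, hsτ⟩ Ψ e hΨ he
    have hsB : (s : WithTop ℝ≥0) < firstHit (sleTrace ((8 : ℝ≥0) / 3) ω) B := by
      rw [hτB]; exact_mod_cast hsτ
    have hsA : (s : WithTop ℝ≥0) < firstHit (sleTrace ((8 : ℝ≥0) / 3) ω) A := by
      rw [hτA]; exact_mod_cast hsτ
    obtain ⟨Ψ', e', hΨ', he', he0', -, hZs⟩ := hrpow s hsB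
    have hle : e ≤ e' := hdom s hsA Ψ e Ψ' e' hΨ he hΨ' he'
    have he'lt : e' < ε := by
      by_contra hge
      push Not at hge
      have : ε ^ ((5 : ℝ) / 8) ≤ e' ^ ((5 : ℝ) / 8) :=
        Real.rpow_le_rpow hε.le hge (by norm_num)
      rw [hZs] at hs
      exact lt_irrefl _ (this.trans_lt hs)
    exact hle.trans_lt he'lt
  -- apply to the side which is hit
  filter_upwards [hYp.ae_exists_eq_rpow, hYp.ae_frozen, hp0, hdp, hYm.ae_exists_eq_rpow,
    hYm.ae_frozen, hm0, hdm] with ω hrp hfp hzp hdop hrm hfm hzm hdomm τ hτ ε hε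
  have hτ0 : 0 < τ := by
    have h := firstHit_sleTrace_pos ((8 : ℝ≥0) / 3) hA.isBoundedHull.isClosed h0A ω
    rw [hτ] at h
    exact_mod_cast h
  -- the hitting point lies in `A₊` or in `A₋`
  obtain ⟨t₀, ht₀, hmem⟩ := exists_firstHit_eq_coe (continuous_sleTrace _ ω)
    hA.isBoundedHull.isClosed (by rw [hτ]; exact WithTop.coe_ne_top)
  have ht₀τ : t₀ = τ := by
    rw [hτ] at ht₀
    exact (WithTop.coe_eq_coe.1 ht₀).symm
  subst ht₀τ
  rw [← hunion] at hmem
  have hsubp : Ap ⊆ A := hunion ▸ subset_union_left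
  have hsubm : Am ⊆ A := hunion ▸ subset_union_right
  have hhit : ∀ {B : Set ℂ}, B ⊆ A → sleTrace ((8 : ℝ≥0) / 3) ω t₀ ∈ B →
      firstHit (sleTrace ((8 : ℝ≥0) / 3) ω) B = t₀ := fun hBA hB ↦
    le_antisymm (firstHit_le hB) (hτ ▸ firstHit_mono _ hBA)
  rcases hmem with h | h
  · exact side hsubp hYp ω hrp hfp hzp hdop t₀ hτ0 hτ (hhit hsubp h) ε hε
  · exact side hsubm hYm ω hrm hfm hzm hdomm t₀ hτ0 hτ (hhit hsubm h) ε hε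

/-! ### [LSW] Thm. 6.1 for a hull from its side parts -/

/-- **Thm. 6.1 for `A = A₊ ⊔ A₋ ∈ 𝒬*` from Thm. 6.1 for its closed parts `A₊, A₋`**: given
restriction martingales of `A`, `A₊`, `A₋`, the lim-sup property of `A` (`hA62`),
that of the parts (`h62₊`, `h62₋`) together with Thm. 6.1 for the parts (`hF₊`, `hF₋`), and
domination (`hdop`, `hdomm`): `P[γ[0,∞) ∩ A = ∅] = Φ'_A(0)^{5/8}`. [folklore] -/
theorem sle_measure_disjoint_eq_of_sideParts [Fact Process.isProjectiveLimit_preWienerMeasure]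
    (huniq : IsStarHull.existsUnique_isRestrictionMap) (hex : IsStarHull.exists_hasRestrictionDeriv)
    (hmeas : ∀ t : ℝ≥0, AEMeasurable (fun ω ↦ sleTrace ((8 : ℝ≥0) / 3) ω t) Process.preWienerMeasure)
    (hA : IsStarHull A)
    {Ap Am : Set ℂ} (hunion : Ap ∪ Am = A) (hAp : IsStarHull Ap) (hAm : IsStarHull Am)
    {Yp Ym : ℝ≥0 → (ℝ≥0 → ℝ) → ℝ} (hY : IsRestrictionMartingale A Y)
    (hYp : IsRestrictionMartingale Ap Yp) (hYm : IsRestrictionMartingale Am Ym)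
    (hA62 : sle_restrictionDeriv_frequently_gt A)
    (h62p : sle_restrictionDeriv_frequently_gt Ap) (h62m : sle_restrictionDeriv_frequently_gt Am)
    {Φp : ConformalEquiv (upperHalfPlaneSet \ Ap) upperHalfPlaneSet} (hΦp : IsRestrictionMap Ap Φp)
    {dp : ℝ} (hdp : HasRestrictionDeriv Ap Φp dp)
    (hFp : Process.preWienerMeasure {ω | Disjoint (range (sleTrace ((8 : ℝ≥0) / 3) ω)) Ap} =
      ENNReal.ofReal (dp ^ ((5 : ℝ) / 8)))
    {Φm : ConformalEquiv (upperHalfPlaneSet \ Am) upperHalfPlaneSet} (hΦm : IsRestrictionMap Am Φm)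
    {dm : ℝ} (hdm : HasRestrictionDeriv Am Φm dm)
    (hFm : Process.preWienerMeasure {ω | Disjoint (range (sleTrace ((8 : ℝ≥0) / 3) ω)) Am} =
      ENNReal.ofReal (dm ^ ((5 : ℝ) / 8)))
    (hdop : sle_restrictionDeriv_dominated A Ap) (hdomm : sle_restrictionDeriv_dominated A Am)
    {Φ : ConformalEquiv (upperHalfPlaneSet \ A) upperHalfPlaneSet} (hΦ : IsRestrictionMap A Φ)
    {d : ℝ} (hd : HasRestrictionDeriv A Φ d) :
    Process.preWienerMeasure {ω | Disjoint (range (sleTrace ((8 : ℝ≥0) / 3) ω)) A} =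
      ENNReal.ofReal (d ^ ((5 : ℝ) / 8)) :=
  hY.measure_disjoint_eq_of_limits huniq hA hΦ hd hA62
    (sle_restrictionDeriv_frequently_lt_of_dominated hA hunion hYp hYm
      (hYp.ae_apply_eq_zero_of_measure_eq huniq hex hmeas hAp hΦp hdp h62p hFp)
      (hYm.ae_apply_eq_zero_of_measure_eq huniq hex hmeas hAm hΦm hdm h62m hFm) hdop hdomm)

end Literature.Probability.RandomPlanarGeometry

end
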